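import Literature.AnabelianGeometry.EtaleTheta.Discharge.Sec3Cor38CriterionCoord
import Literature.AnabelianGeometry.EtaleTheta.RealificationOrderWeak
import Literature.AnabelianGeometry.EtaleTheta.FrdIVocabularyWeak
import Literature.AlgebraicGeometry.Frobenioids.RlfStructureWeak
import HarnessLib

/-!
# [EtTh] Corollary 3.8 (i) sub-DAG — row C38-L05 part (d) WITHOUT `hSup` at the WEAK tree vocabulary
# (`treeMonoidVocabWeak`: weakly perf-factorial divisor monoids with cofinal perfection), and the
# vocabulary-free core of the coordinate argument

Mochizuki, *The étale theta function …*, Publ. RIMS **45** (2009), Cor. 3.8, proof PDF p.81 l.20–27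
[cite: MochizukiEtTh2009, Cor 3.8 p.81]; [FrdI] Def. 1.3 (iii)(d) / Def. 2.4 (i) (kurims pp.24, 47–48)
[cite: MochizukiFrdI2008, Def. 2.4(i) p.47].

abc-iut cell, layer L2, seat abc-iut-w4-d084 (row «C38-L05d-coord», abc-iut-L2-lead ROWS #13-addendum (3):
«at treeMonoidVocab / treeMonoidVocabWeak»).  Companion of `Discharge/Sec3Cor38CriterionCoord.lean` (same seat),
which settles the TREE vocabulary.  THIS FILE:
* §A — the VOCABULARY-FREE core: for ANY monoid vocabulary `V`, the (⇐) direction of part (d)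
  (`isBaseFieldTheoreticDiv_of_isLUB_bsFldPf_of_pfCoord`) and the exclusion of the `ℝ`-type line
  (`not_isRMonoprime_bsFld_of_pfCoord`) GIVEN a coordinate package on `Φ(W)^pf` — an injective ORDER EMBEDDING
  `κ : Φ(W)^pf ↪ ∏_𝔮 ℝ_{≥0}` with rational coordinates prime by prime ([FrdI] Def. 2.4 (i)) — and sharpness of
  `Φ(W)`; the proofs are those of the companion file, verbatim, with the package as a parameter;
* §B — the package EXISTS for WEAKLY perf-factorial monoids (`Cor38Coord.exists_pfCoord_weak`: abc-iut-L2-d2's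
  `IsPerfFactorialWeak` API — `RlfCoordWeak.toRealification_dvd_iff`, `IsPerfFactorialWeak.Rlf.dvd_iff`,
  `RlfCoordWeak.isMonoprime_pfAt` — and the charts of `RealificationCoordinates`), exactly as for `IsPerfFactorial`;
* §C — row C38-L05 at `treeMonoidVocabWeak` WITHOUT `hSup`: `isBaseFieldTheoreticDiv_iff_isLUB_divOPf_coordWeak`,
  `not_isRMonoprime_bsFld_weak` / `isZQMonoprime_bsFld_weak` (the side condition `hΛ` DERIVED from `hQ` + `hNZ`),
  and **`bsFldPreStepLimitCriterion_of_coordWeak (hF) (hP34Λ) (hNZ) (hQ)`**.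
Side condition `hQ` («every localized perfection `Φ(W)^pf_𝔮` is `ℚ`-monoprime», [FrdI] §0: monoids of effective
`ℤ`-divisors; GAP-LEDGER G-w4d084-3) as in the companion.  HONEST FRAMING: refereed pre-IUT material; nothing here
bears on [IUTchIII] Cor. 3.12; typed ≠ proved elsewhere.
-/

namespace Literature.AnabelianGeometry.EtaleTheta

open CategoryTheory Opposite Function NNReal Literature.AlgebraicGeometry.Frobenioids

universe u₀ v₀ u v w

variable {D₀ : Type u₀} [Category.{v₀} D₀] {V : FrdIMonoidStub.{w}}
  {T : RealifiedDivisorMonoids (D₀ := D₀) V} {D : Type u} [Category.{v} D] {VD : FrdICatStub.{u, v, w} D}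

namespace TemperedFrobenioid

/-! ### §A The vocabulary-free core: part (d) (⇐) and the exclusion of the `ℝ`-line from a coordinate package -/

section Core

variable {C : TemperedFrobenioid T D VD}

/-- A nonnegative real below `b + c/n` for every `n ≥ 1` is `≤ b`. [folklore] -/
private theorem nnreal_le_of_forall_le_add_div' {a b c : ℝ≥0} (h : ∀ n : ℕ, 0 < n → a ≤ b + c / n) :
    a ≤ b := by
  refine le_of_forall_pos_le_add fun ε hε => ?_
  obtain ⟨n, hn⟩ := exists_nat_gt (c / ε)
  have hn1 : c / ε < ((n + 1 : ℕ) : ℝ≥0) := hn.trans (by exact_mod_cast Nat.lt_succ_self n)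
  have hpos : (0 : ℝ≥0) < ((n + 1 : ℕ) : ℝ≥0) := by exact_mod_cast Nat.succ_pos n
  have hcn : c / ((n + 1 : ℕ) : ℝ≥0) ≤ ε := by
    rw [div_le_iff₀ hpos]
    rw [div_lt_iff₀ hε, mul_comm] at hn1
    exact hn1.le
  exact (h (n + 1) (Nat.succ_pos n)).trans (add_le_add le_rfl hcn)

/-- **Part (d), direction (⇐), from a coordinate package** (any monoid vocabulary): if `Φ(W)` is sharp and carries
an injective order embedding `κ : Φ(W)^pf ↪ ∏_𝔮 ℝ_{≥0}` with rational coordinates prime by prime, `Φ^{bs-fld}(W)` is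
of type `ℤ` or `ℚ`, `Z₀ ≠ 1` is base-field-theoretic and `x^{1/1}` is the least upper bound of a nonempty family of
roots of base-field-theoretic elements dividing it, then `x` is base-field-theoretic (proof of the companion's
`isBaseFieldTheoreticDiv_of_isLUB_bsFldPf`, verbatim, with the package as a parameter).
[cite: MochizukiEtTh2009, Cor 3.8 p.81] -/
theorem isBaseFieldTheoreticDiv_of_isLUB_bsFldPf_of_pfCoord {W : D}
    (hΛ : IsZMonoprime ↥(C.bsFld.carrier (op W)) ∨ IsQMonoprime ↥(C.bsFld.carrier (op W)))
    (hsharp : IsSharp (C.divisorMonoid.obj (op W)))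
    (κ : Perfection (C.divisorMonoid.obj (op W)) →*
      (Primes (Perfection (C.divisorMonoid.obj (op W))) → Multiplicative ℝ≥0))
    (hinj : Injective κ) (hord : ∀ a b : Perfection (C.divisorMonoid.obj (op W)), a ∣ b ↔ κ a ≤ κ b)
    (hrat : ∀ 𝔮 : Primes (Perfection (C.divisorMonoid.obj (op W))), ∃ c : ℝ≥0, c ≠ 0 ∧
      ∀ a : Perfection (C.divisorMonoid.obj (op W)), ∃ q : ℚ≥0, Multiplicative.toAdd (κ a 𝔮) = c * (q : ℝ≥0))
    {Z₀ : C.divisorMonoid.obj (op W)} (hZ₀b : C.IsBaseFieldTheoreticDiv Z₀) (hZ₀1 : Z₀ ≠ 1)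
    (x : C.divisorMonoid.obj (op W)) {S : Set (Perfection (C.divisorMonoid.obj (op W)))}
    (hS : S ⊆ C.bsFldPf W) (hne : S.Nonempty)
    (hbd : ∀ s ∈ S, s ∣ Perfection.of (C.divisorMonoid.obj (op W)) x)
    (hlub : ∀ z, (∀ s ∈ S, s ∣ z) → Perfection.of (C.divisorMonoid.obj (op W)) x ∣ z) :
    C.IsBaseFieldTheoreticDiv x := by
  classical
  -- additive coordinates
  let X : Perfection (C.divisorMonoid.obj (op W)) → Primes (Perfection (C.divisorMonoid.obj (op W))) → ℝ≥0 :=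
    fun a 𝔮 => Multiplicative.toAdd (κ a 𝔮)
  have hXpow : ∀ a (n : ℕ) 𝔮, X (a ^ n) 𝔮 = n * X a 𝔮 := by
    intro a n 𝔮
    change Multiplicative.toAdd (κ (a ^ n) 𝔮) = n * Multiplicative.toAdd (κ a 𝔮)
    rw [map_pow, Pi.pow_apply, toAdd_pow, nsmul_eq_mul]
  have hXle : ∀ a b, a ∣ b ↔ ∀ 𝔮, X a 𝔮 ≤ X b 𝔮 := by
    intro a b
    rw [hord a b, Pi.le_def]
    exact forall_congr' fun 𝔮 => (Multiplicative.toAdd_le).symm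
  have hXinj : ∀ a b, (∀ 𝔮, X a 𝔮 = X b 𝔮) → a = b := by
    intro a b h
    exact hinj (funext fun 𝔮 => Multiplicative.toAdd.injective (h 𝔮))
  -- the direction `w` of the line and a prime where it is visible
  let w : Primes (Perfection (C.divisorMonoid.obj (op W))) → ℝ≥0 :=
    X (Perfection.of (C.divisorMonoid.obj (op W)) Z₀)
  have hw0 : ∃ 𝔮₀, w 𝔮₀ ≠ 0 := by
    by_contra hall
    apply hZ₀1
    have h1 : Perfection.of (C.divisorMonoid.obj (op W)) Z₀ = 1 :=
      hXinj _ _ fun 𝔮 => by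
        have hw : w 𝔮 = 0 := not_not.mp (not_exists.mp hall 𝔮)
        change w 𝔮 = Multiplicative.toAdd (κ 1 𝔮)
        rw [map_one, Pi.one_apply, toAdd_one]
        exact hw
    exact (Perfection.mk_eq_one_iff_of_isSharp hsharp).mp h1
  obtain ⟨𝔮₀, h𝔮₀⟩ := hw0
  -- roots of powers of `Z₀` in coordinates: `X ((Z₀^p)^{1/N}) = (p/N) · w`
  have hroot : ∀ (p : ℕ) (N : ℕ+) 𝔮, X (Perfection.mk (Z₀ ^ p) N) 𝔮 = (p : ℝ≥0) / N * w 𝔮 := by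
    intro p N 𝔮
    have h := hXpow (Perfection.mk (Z₀ ^ p) N) N 𝔮
    rw [Perfection.mk_pow_self, map_pow, hXpow] at h
    -- `h : p * w 𝔮 = N * X (mk (Z₀^p) N) 𝔮`
    have hN : (N : ℝ≥0) ≠ 0 := by exact_mod_cast N.ne_zero
    rw [div_mul_eq_mul_div, eq_div_iff hN, mul_comm]
    exact h.symm
  -- every `s ∈ S` lies on the line: `X s = t_s · w` with `t_s ≥ 0`
  have hline : ∀ s ∈ S, ∃ t : ℝ≥0, ∀ 𝔮, X s 𝔮 = t * w 𝔮 := by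
    intro s hs
    obtain ⟨l, N, hl, rfl⟩ := hS hs
    obtain ⟨a, b, ha, hab⟩ := exists_pow_eq_pow_of_isBaseFieldTheoreticDiv hΛ hl hZ₀b hZ₀1
    refine ⟨(b : ℝ≥0) / ((N : ℕ) * a : ℕ), fun 𝔮 => ?_⟩
    have hpow : Perfection.mk l N ^ ((N : ℕ) * a) = Perfection.of (C.divisorMonoid.obj (op W)) (Z₀ ^ b) := by
      rw [pow_mul, Perfection.mk_pow_self, ← map_pow]
      exact congrArg (Perfection.of (C.divisorMonoid.obj (op W))) hab
    have h : X (Perfection.mk l N ^ ((N : ℕ) * a)) 𝔮 = X (Perfection.of (C.divisorMonoid.obj (op W)) (Z₀ ^ b)) 𝔮 := by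
      rw [hpow]
    rw [hXpow, map_pow, hXpow] at h
    have hNa : (((N : ℕ) * a : ℕ) : ℝ≥0) ≠ 0 := by exact_mod_cast (Nat.mul_pos N.pos ha).ne'
    rw [div_mul_eq_mul_div, eq_div_iff hNa, mul_comm]
    exact h
  choose t ht using hline
  -- the supremum of the line coordinates of `S`
  let tS : Set ℝ≥0 := {r | ∃ (s : _) (hs : s ∈ S), r = t s hs}
  have htS_ne : tS.Nonempty := by obtain ⟨s, hs⟩ := hne; exact ⟨t s hs, s, hs, rfl⟩
  have hXx_ge : ∀ s (hs : s ∈ S) 𝔮, t s hs * w 𝔮 ≤ X (Perfection.of (C.divisorMonoid.obj (op W)) x) 𝔮 := by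
    intro s hs 𝔮
    rw [← ht s hs 𝔮]
    exact (hXle _ _).mp (hbd s hs) 𝔮
  have htS_bdd : BddAbove tS := by
    refine ⟨X (Perfection.of (C.divisorMonoid.obj (op W)) x) 𝔮₀ / w 𝔮₀, ?_⟩
    rintro _ ⟨s, hs, rfl⟩
    rw [le_div_iff₀ (pos_iff_ne_zero.mpr h𝔮₀)]
    exact hXx_ge s hs 𝔮₀
  set α : ℝ≥0 := sSup tS with hα
  have ht_le : ∀ s (hs : s ∈ S), t s hs ≤ α := fun s hs => le_csSup htS_bdd ⟨s, hs, rfl⟩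
  -- lower bound: `α · w ≤ X x`
  have hlow : ∀ 𝔮, α * w 𝔮 ≤ X (Perfection.of (C.divisorMonoid.obj (op W)) x) 𝔮 := by
    intro 𝔮
    by_cases hw : w 𝔮 = 0
    · rw [hw, mul_zero]; exact zero_le
    · rw [← le_div_iff₀ (pos_iff_ne_zero.mpr hw)]
      refine csSup_le htS_ne ?_
      rintro _ ⟨s, hs, rfl⟩
      rw [le_div_iff₀ (pos_iff_ne_zero.mpr hw)]
      exact hXx_ge s hs 𝔮
  -- upper bound: `X x ≤ (p/N) · w` whenever `α < p/N`, by testing the upper bound `(Z₀^p)^{1/N}` of `S`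
  have hup' : ∀ (p : ℕ) (N : ℕ+), α < (p : ℝ≥0) / N →
      ∀ 𝔮, X (Perfection.of (C.divisorMonoid.obj (op W)) x) 𝔮 ≤ (p : ℝ≥0) / N * w 𝔮 := by
    intro p N hpN
    have hz : ∀ s ∈ S, s ∣ Perfection.mk (Z₀ ^ p) N := by
      intro s hs
      refine (hXle _ _).mpr fun 𝔮 => ?_
      rw [ht s hs 𝔮, hroot]
      exact mul_le_mul_of_nonneg_right ((ht_le s hs).trans hpN.le) zero_le
    intro 𝔮
    rw [← hroot]
    exact (hXle _ _).mp (hlub _ hz) 𝔮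
  have hup : ∀ 𝔮, X (Perfection.of (C.divisorMonoid.obj (op W)) x) 𝔮 ≤ α * w 𝔮 := by
    intro 𝔮
    refine nnreal_le_of_forall_le_add_div' (c := w 𝔮) fun N hN => ?_
    -- `p := ⌊α N⌋ + 1`, so that `α < p/N ≤ α + 1/N`
    let N' : ℕ+ := ⟨N, hN⟩
    let p : ℕ := ⌊α * N⌋₊ + 1
    have hNN : ((N' : ℕ) : ℝ≥0) = (N : ℝ≥0) := rfl
    have hNpos : (0 : ℝ≥0) < (N : ℝ≥0) := by exact_mod_cast hN
    have h1 : α < (p : ℝ≥0) / (N' : ℕ) := by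
      rw [hNN, lt_div_iff₀ hNpos]
      show α * (N : ℝ≥0) < ((⌊α * (N : ℝ≥0)⌋₊ + 1 : ℕ) : ℝ≥0)
      push_cast
      exact Nat.lt_floor_add_one _
    have h2 : (p : ℝ≥0) / (N' : ℕ) ≤ α + 1 / N := by
      rw [hNN, div_le_iff₀ hNpos, add_mul, one_div, inv_mul_cancel₀ hNpos.ne']
      show ((⌊α * (N : ℝ≥0)⌋₊ + 1 : ℕ) : ℝ≥0) ≤ α * (N : ℝ≥0) + 1
      push_cast
      exact add_le_add (Nat.floor_le zero_le) le_rfl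
    calc X (Perfection.of (C.divisorMonoid.obj (op W)) x) 𝔮 ≤ (p : ℝ≥0) / (N' : ℕ) * w 𝔮 := hup' p N' h1 𝔮
      _ ≤ (α + 1 / N) * w 𝔮 := mul_le_mul_of_nonneg_right h2 zero_le
      _ = α * w 𝔮 + w 𝔮 / N := by rw [add_mul, one_div, inv_mul_eq_div]
  have hXx : ∀ 𝔮, X (Perfection.of (C.divisorMonoid.obj (op W)) x) 𝔮 = α * w 𝔮 :=
    fun 𝔮 => le_antisymm (hup 𝔮) (hlow 𝔮)
  -- rationality of `α` from the `ℚ`-monoprime prime `𝔮₀`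
  obtain ⟨c, hc, hcq⟩ := hrat 𝔮₀
  obtain ⟨q₁, hq₁⟩ := hcq (Perfection.of (C.divisorMonoid.obj (op W)) x)
  obtain ⟨q₂, hq₂⟩ := hcq (Perfection.of (C.divisorMonoid.obj (op W)) Z₀)
  change X (Perfection.of (C.divisorMonoid.obj (op W)) x) 𝔮₀ = c * q₁ at hq₁
  change w 𝔮₀ = c * q₂ at hq₂
  have hq₂0 : q₂ ≠ 0 := by
    intro h; apply h𝔮₀; rw [hq₂, h, NNRat.cast_zero, mul_zero]
  have hq₂0' : ((q₂ : ℚ≥0) : ℝ≥0) ≠ 0 := by exact_mod_cast hq₂0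
  set ρ : ℚ≥0 := q₁ / q₂ with hρ
  have hαq : α = (ρ : ℝ≥0) := by
    have h := hXx 𝔮₀
    rw [hq₁, hq₂, ← mul_assoc, mul_comm α c, mul_assoc] at h
    have h' : ((q₁ : ℚ≥0) : ℝ≥0) = α * q₂ := mul_left_cancel₀ hc h
    rw [hρ, NNRat.cast_div, eq_div_iff hq₂0', h']
  -- `α = num/den`
  let qd : ℕ+ := ⟨ρ.den, ρ.den_pos⟩
  have hαpq : α = (ρ.num : ℝ≥0) / (qd : ℕ) := by
    have h := NNRat.den_mul_eq_num ρ
    have h' : ((ρ.den : ℚ≥0) : ℝ≥0) * (ρ : ℝ≥0) = ((ρ.num : ℚ≥0) : ℝ≥0) := by rw [← NNRat.cast_mul, h]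
    rw [NNRat.cast_natCast, NNRat.cast_natCast] at h'
    have hden : ((qd : ℕ) : ℝ≥0) ≠ 0 := by exact_mod_cast ρ.den_ne_zero
    rw [hαq, eq_div_iff hden, mul_comm]
    exact h'
  -- hence `x^{1/1} = (Z₀^num)^{1/den}`, a root of a base-field-theoretic element
  have hxeq : Perfection.of (C.divisorMonoid.obj (op W)) x = Perfection.mk (Z₀ ^ ρ.num) qd :=
    hXinj _ _ fun 𝔮 => by rw [hXx, hroot, hαpq]
  rw [← of_mem_bsFldPf_iff x, hxeq]
  exact ⟨Z₀ ^ ρ.num, qd, isBaseFieldTheoreticDiv_pow hZ₀b _, rfl⟩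

/-- **`Φ^{bs-fld}(W)` is not `ℝ`-monoprime, from a coordinate package** (any monoid vocabulary): the would-be
`ℝ`-line `t ↦ Z₀^t` has coordinates `t · κ(Z₀)`, which at a prime where `κ(Z₀) ≠ 0` are rational multiples of one
constant — impossible at `t = √2` (proof of the companion's `not_isRMonoprime_bsFld`, verbatim).
[cite: MochizukiFrdI2008, Def. 2.4(i) p.47] -/
theorem not_isRMonoprime_bsFld_of_pfCoord {W : D}
    (hsharp : IsSharp (C.divisorMonoid.obj (op W)))
    (κ : Perfection (C.divisorMonoid.obj (op W)) →*
      (Primes (Perfection (C.divisorMonoid.obj (op W))) → Multiplicative ℝ≥0))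
    (hinj : Injective κ) (hord : ∀ a b : Perfection (C.divisorMonoid.obj (op W)), a ∣ b ↔ κ a ≤ κ b)
    (hrat : ∀ 𝔮 : Primes (Perfection (C.divisorMonoid.obj (op W))), ∃ c : ℝ≥0, c ≠ 0 ∧
      ∀ a : Perfection (C.divisorMonoid.obj (op W)), ∃ q : ℚ≥0, Multiplicative.toAdd (κ a 𝔮) = c * (q : ℝ≥0))
    {Z₀ : C.divisorMonoid.obj (op W)} (hZ₀b : C.IsBaseFieldTheoreticDiv Z₀) (hZ₀1 : Z₀ ≠ 1) :
    ¬ IsRMonoprime ↥(C.bsFld.carrier (op W)) := by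
  rintro ⟨⟨e⟩⟩
  classical
  -- additive coordinates (as in §4)
  let X : Perfection (C.divisorMonoid.obj (op W)) → Primes (Perfection (C.divisorMonoid.obj (op W))) → ℝ≥0 :=
    fun a 𝔮 => Multiplicative.toAdd (κ a 𝔮)
  have hXpow : ∀ a (n : ℕ) 𝔮, X (a ^ n) 𝔮 = n * X a 𝔮 := by
    intro a n 𝔮
    change Multiplicative.toAdd (κ (a ^ n) 𝔮) = n * Multiplicative.toAdd (κ a 𝔮)
    rw [map_pow, Pi.pow_apply, toAdd_pow, nsmul_eq_mul]
  have hXle : ∀ a b, a ∣ b ↔ ∀ 𝔮, X a 𝔮 ≤ X b 𝔮 := by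
    intro a b
    rw [hord a b, Pi.le_def]
    exact forall_congr' fun 𝔮 => (Multiplicative.toAdd_le).symm
  have hXinj : ∀ a b, (∀ 𝔮, X a 𝔮 = X b 𝔮) → a = b := by
    intro a b h
    exact hinj (funext fun 𝔮 => Multiplicative.toAdd.injective (h 𝔮))
  let w : Primes (Perfection (C.divisorMonoid.obj (op W))) → ℝ≥0 :=
    X (Perfection.of (C.divisorMonoid.obj (op W)) Z₀)
  have hw0 : ∃ 𝔮₀, w 𝔮₀ ≠ 0 := by
    by_contra hall
    apply hZ₀1
    have h1 : Perfection.of (C.divisorMonoid.obj (op W)) Z₀ = 1 :=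
      hXinj _ _ fun 𝔮 => by
        have hw : w 𝔮 = 0 := not_not.mp (not_exists.mp hall 𝔮)
        change w 𝔮 = Multiplicative.toAdd (κ 1 𝔮)
        rw [map_one, Pi.one_apply, toAdd_one]
        exact hw
    exact (Perfection.mk_eq_one_iff_of_isSharp hsharp).mp h1
  obtain ⟨𝔮₀, h𝔮₀⟩ := hw0
  -- the would-be `ℝ`-line through `Z₀`: `ψ(t) = e⁻¹(t · e(Z₀))`, a homomorphism `ℝ_{≥0} → Φ(W)` with `ψ(1) = Z₀`
  let Zb : ↥(C.bsFld.carrier (op W)) := ⟨_, hZ₀b⟩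
  let s₀ : ℝ≥0 := Multiplicative.toAdd (e Zb)
  let ψ : Multiplicative ℝ≥0 →* C.divisorMonoid.obj (op W) :=
    (Submonoid.inclusion (C.bsFld_le (op W))).comp
      (e.symm.toMonoidHom.comp (AddMonoidHom.toMultiplicative (AddMonoidHom.mulLeft s₀)))
  have hψ : ∀ t : ℝ≥0, ψ (Multiplicative.ofAdd t) =
      Submonoid.inclusion (C.bsFld_le (op W)) (e.symm (Multiplicative.ofAdd (s₀ * t))) := fun _ => rfl
  have hψ1 : ψ (Multiplicative.ofAdd 1) = Z₀ := by
    rw [hψ, mul_one]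
    have h2 : e.symm (Multiplicative.ofAdd s₀) = Zb := by
      rw [MulEquiv.symm_apply_eq]
      exact (ofAdd_toAdd _).symm
    rw [h2]
    exact Subtype.ext rfl
  -- its coordinates: `G t := X (ψ t)`; monotone, `G (n • t) = n • G t`, `G 1 = w`
  let G : ℝ≥0 → Primes (Perfection (C.divisorMonoid.obj (op W))) → ℝ≥0 :=
    fun t => X (Perfection.of (C.divisorMonoid.obj (op W)) (ψ (Multiplicative.ofAdd t)))
  have hGmono : ∀ {t t' : ℝ≥0}, t ≤ t' → ∀ 𝔮, G t 𝔮 ≤ G t' 𝔮 := by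
    intro t t' htt'
    refine (hXle _ _).mp (map_dvd _ (map_dvd ψ ?_))
    exact (RealificationCoord.mnnreal_dvd_iff_le _ _).mpr htt'
  have hGnat : ∀ (p : ℕ) (N : ℕ+) 𝔮, G ((p : ℝ≥0) / (N : ℕ)) 𝔮 = (p : ℝ≥0) / (N : ℕ) * w 𝔮 := by
    intro p N 𝔮
    have hN : ((N : ℕ) : ℝ≥0) ≠ 0 := by exact_mod_cast N.ne_zero
    have h1 : (Multiplicative.ofAdd ((p : ℝ≥0) / (N : ℕ))) ^ (N : ℕ) = (Multiplicative.ofAdd (1 : ℝ≥0)) ^ p := by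
      rw [← ofAdd_nsmul, ← ofAdd_nsmul, nsmul_eq_mul, nsmul_eq_mul, mul_one, mul_div_cancel₀ _ hN]
    have h2 := congrArg (fun m => X (Perfection.of (C.divisorMonoid.obj (op W)) (ψ m)) 𝔮) h1
    simp only [map_pow, hXpow] at h2
    rw [hψ1] at h2
    -- `h2 : N * G (p/N) 𝔮 = p * w 𝔮`
    rw [div_mul_eq_mul_div, eq_div_iff hN, mul_comm]
    exact h2
  -- hence `G t = t · w` for every real `t ≥ 0` (squeeze between `⌊tN⌋/N` and `(⌊tN⌋+1)/N`)
  have hGt : ∀ (t : ℝ≥0) 𝔮, G t 𝔮 = t * w 𝔮 := by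
    intro t 𝔮
    have key : ∀ N : ℕ, 0 < N →
        G t 𝔮 ≤ t * w 𝔮 + w 𝔮 / N ∧ t * w 𝔮 ≤ G t 𝔮 + w 𝔮 / N := by
      intro N hN
      let N' : ℕ+ := ⟨N, hN⟩
      have hNN : ((N' : ℕ) : ℝ≥0) = (N : ℝ≥0) := rfl
      have hNpos : (0 : ℝ≥0) < (N : ℝ≥0) := by exact_mod_cast hN
      let p : ℕ := ⌊t * N⌋₊
      have hlo : (p : ℝ≥0) / N ≤ t := by
        rw [div_le_iff₀ hNpos]
        exact Nat.floor_le zero_le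
      have hhi : t ≤ ((p + 1 : ℕ) : ℝ≥0) / N := by
        rw [le_div_iff₀ hNpos]
        push_cast
        exact (Nat.lt_floor_add_one _).le
      have hhi' : ((p + 1 : ℕ) : ℝ≥0) / N ≤ t + 1 / N := by
        rw [div_le_iff₀ hNpos, add_mul, one_div, inv_mul_cancel₀ hNpos.ne']
        push_cast
        exact add_le_add (Nat.floor_le zero_le) le_rfl
      have hlo' : t ≤ (p : ℝ≥0) / N + 1 / N := by
        rw [← add_div, le_div_iff₀ hNpos]
        push_cast at hhi ⊢
        rw [le_div_iff₀ hNpos] at hhi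
        exact hhi
      constructor
      · calc G t 𝔮 ≤ G (((p + 1 : ℕ) : ℝ≥0) / (N' : ℕ)) 𝔮 := hGmono (hNN ▸ hhi) 𝔮
          _ = ((p + 1 : ℕ) : ℝ≥0) / (N' : ℕ) * w 𝔮 := hGnat (p + 1) N' 𝔮
          _ ≤ (t + 1 / N) * w 𝔮 := mul_le_mul_of_nonneg_right (hNN ▸ hhi') zero_le
          _ = t * w 𝔮 + w 𝔮 / N := by rw [add_mul, one_div, inv_mul_eq_div]
      · calc t * w 𝔮 ≤ ((p : ℝ≥0) / N + 1 / N) * w 𝔮 := mul_le_mul_of_nonneg_right hlo' zero_le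
          _ = (p : ℝ≥0) / (N' : ℕ) * w 𝔮 + w 𝔮 / N := by rw [add_mul, one_div, inv_mul_eq_div, hNN]
          _ = G ((p : ℝ≥0) / (N' : ℕ)) 𝔮 + w 𝔮 / N := by rw [hGnat p N' 𝔮]
          _ ≤ G t 𝔮 + w 𝔮 / N := add_le_add (hGmono (hNN ▸ hlo) 𝔮) le_rfl
    exact le_antisymm (nnreal_le_of_forall_le_add_div' fun N hN => (key N hN).1)
      (nnreal_le_of_forall_le_add_div' fun N hN => (key N hN).2)
  -- at `𝔮₀` all coordinates are rational multiples of `c`; apply to `t = √2`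
  obtain ⟨c, hc, hcq⟩ := hrat 𝔮₀
  obtain ⟨q₂, hq₂⟩ := hcq (Perfection.of (C.divisorMonoid.obj (op W)) Z₀)
  change w 𝔮₀ = c * q₂ at hq₂
  have hq₂0 : q₂ ≠ 0 := by
    intro h; apply h𝔮₀; rw [hq₂, h, NNRat.cast_zero, mul_zero]
  have hq₂0' : ((q₂ : ℚ≥0) : ℝ≥0) ≠ 0 := by exact_mod_cast hq₂0
  let t : ℝ≥0 := ⟨Real.sqrt 2, Real.sqrt_nonneg 2⟩
  obtain ⟨q, hq⟩ := hcq (Perfection.of (C.divisorMonoid.obj (op W)) (ψ (Multiplicative.ofAdd t)))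
  change G t 𝔮₀ = c * q at hq
  rw [hGt, hq₂, ← mul_assoc, mul_comm t c, mul_assoc] at hq
  have ht : t = ((q / q₂ : ℚ≥0) : ℝ≥0) := by
    rw [NNRat.cast_div, eq_div_iff hq₂0']
    exact mul_left_cancel₀ hc hq
  refine irrational_sqrt_two ⟨((q / q₂ : ℚ≥0) : ℚ), ?_⟩
  have ht' : ((t : ℝ≥0) : ℝ) = Real.sqrt 2 := rfl
  rw [← ht', ht]
  push_cast
  rfl


end Core

end TemperedFrobenioid

/-! ### §B The coordinate package of a WEAKLY perf-factorial monoid -/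

namespace Cor38Coord

variable {M : Type w} [CommMonoid M]

/-- **Coordinates on `M^pf`** for a WEAKLY perf-factorial `M` (abc-iut-L2-d2's `IsPerfFactorialWeak`: (a)(b)(c) +
(d_ord) + (d_res)): an injective homomorphism `κ : M^pf → ∏_𝔮 ℝ_{≥0}` which is an order embedding for `∣`
(`RlfCoordWeak.toRealification_dvd_iff` + `IsPerfFactorialWeak.Rlf.dvd_iff` + the charts), with rational
coordinates at every `ℚ`-monoprime prime. [cite: MochizukiFrdI2008, Def. 2.4(i) p.47] -/
theorem exists_pfCoord_weak (hM : IsPerfFactorialWeak M) :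
    ∃ κ : Perfection M →* (Primes (Perfection M) → Multiplicative ℝ≥0),
      Injective κ ∧ (∀ a b : Perfection M, a ∣ b ↔ κ a ≤ κ b) ∧
      ∀ 𝔮 : Primes (Perfection M), IsQMonoprime (PfAt M 𝔮) →
        ∃ c : ℝ≥0, c ≠ 0 ∧ ∀ a : Perfection M, ∃ q : ℚ≥0, Multiplicative.toAdd (κ a 𝔮) = c * (q : ℝ≥0) := by
  classical
  have hb : ∀ 𝔮 : Primes (Perfection M), IsMonoprime (PfAt M 𝔮) :=
    fun 𝔮 => RlfCoordWeak.isMonoprime_pfAt hM 𝔮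
  let f : ∀ 𝔮 : Primes (Perfection M), RlfAt M 𝔮 ≃* Multiplicative ℝ≥0 :=
    fun 𝔮 => Classical.choice (RealificationCoord.nonempty_coord (hb 𝔮))
  let Fe : RlfFactor M ≃* (Primes (Perfection M) → Multiplicative ℝ≥0) := MulEquiv.piCongrRight f
  let κ : Perfection M →* (Primes (Perfection M) → Multiplicative ℝ≥0) := Fe.toMonoidHom.comp hM.factorHom
  have hκ : ∀ (a : Perfection M) (𝔮 : Primes (Perfection M)), κ a 𝔮 = f 𝔮 (factorMap M a 𝔮) := fun _ _ => rfl
  refine ⟨κ, fun a b h => hM.factorMap_injective (Fe.injective h), fun a b => ?_, fun 𝔮 h𝔮 => ?_⟩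
  · rw [← RlfCoordWeak.toRealification_dvd_iff hM hb a b, IsPerfFactorialWeak.Rlf.dvd_iff]
    change (∀ 𝔮, factorMap M a 𝔮 ∣ factorMap M b 𝔮) ↔ _
    constructor
    · intro h 𝔮
      rw [hκ, hκ]
      exact (RealificationCoord.mnnreal_dvd_iff_le _ _).mp (map_dvd (f 𝔮) (h 𝔮))
    · intro h 𝔮
      have h' : f 𝔮 (factorMap M a 𝔮) ∣ f 𝔮 (factorMap M b 𝔮) :=
        (RealificationCoord.mnnreal_dvd_iff_le _ _).mpr (by rw [← hκ, ← hκ]; exact h 𝔮)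
      exact (map_dvd_iff (f 𝔮)).mp h'
  · obtain ⟨⟨e⟩⟩ := h𝔮
    obtain ⟨c, hc, hg⟩ := RealificationCoord.chart_Q (f 𝔮) e
    refine ⟨c, hc, fun a => ?_⟩
    obtain ⟨xF, hxF⟩ := hM.factorMap_mem_range a
    have h1 : factorMap M a 𝔮 = Realification.of (PfAt M 𝔮) (xF 𝔮) := by
      rw [← hxF]; rfl
    refine ⟨Multiplicative.toAdd (e (xF 𝔮)), ?_⟩
    rw [hκ, h1, hg]

end Cor38Coord

/-! ### §C Row C38-L05 at the WEAK tree vocabulary, without `hSup` (and without `hΛ`) -/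

namespace TemperedFrobenioid

section Weak

/-- At the weak tree vocabulary the divisor monoid `Φ(W)` is WEAKLY perf-factorial (the typed field
`isPerfFactorial` read through `treeMonoidVocabWeak` = `IsPerfFactorialCof` = weak + cofinal).
[cite: MochizukiEtTh2009, Def 3.6 p.77] -/
theorem isPerfFactorialWeak_divisorMonoid {T' : RealifiedDivisorMonoids (D₀ := D₀) treeMonoidVocabWeak.{w}}
    {C : TemperedFrobenioid T' D VD} (W : D) : IsPerfFactorialWeak (C.divisorMonoid.obj (op W)) := by
  obtain ⟨h, -⟩ := (C.isPerfFactorial (op W) : IsPerfFactorialCof (C.divisorMonoid.obj (op W)))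
  exact h

/-- **`Φ^{bs-fld}(W)` is not `ℝ`-monoprime** (weak tree vocabulary), from `hQ` and a nontrivial
base-field-theoretic `Z₀`. [cite: MochizukiFrdI2008, Def. 2.4(i) p.47] -/
theorem not_isRMonoprime_bsFld_weak
    {T' : RealifiedDivisorMonoids (D₀ := D₀) treeMonoidVocabWeak.{w}} {C : TemperedFrobenioid T' D VD} {W : D}
    (hQ : ∀ 𝔮 : Primes (Perfection (C.divisorMonoid.obj (op W))),
      IsQMonoprime (PfAt (C.divisorMonoid.obj (op W)) 𝔮))
    {Z₀ : C.divisorMonoid.obj (op W)} (hZ₀b : C.IsBaseFieldTheoreticDiv Z₀) (hZ₀1 : Z₀ ≠ 1) :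
    ¬ IsRMonoprime ↥(C.bsFld.carrier (op W)) := by
  have hM := isPerfFactorialWeak_divisorMonoid (C := C) W
  obtain ⟨κ, hinj, hord, hrat⟩ := Cor38Coord.exists_pfCoord_weak hM
  exact not_isRMonoprime_bsFld_of_pfCoord hM.isDivisorial.isSharp κ hinj hord (fun 𝔮 => hrat 𝔮 (hQ 𝔮))
    hZ₀b hZ₀1

/-- **`hΛ` from `hQ`** (weak tree vocabulary): `Φ^{bs-fld}(W)` is of type `ℤ` or `ℚ`.
[cite: MochizukiEtTh2009, Def 3.6 p.77] -/
theorem isZQMonoprime_bsFld_weak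
    {T' : RealifiedDivisorMonoids (D₀ := D₀) treeMonoidVocabWeak.{w}} {C : TemperedFrobenioid T' D VD} {W : D}
    (hQ : ∀ 𝔮 : Primes (Perfection (C.divisorMonoid.obj (op W))),
      IsQMonoprime (PfAt (C.divisorMonoid.obj (op W)) 𝔮))
    {Z₀ : C.divisorMonoid.obj (op W)} (hZ₀b : C.IsBaseFieldTheoreticDiv Z₀) (hZ₀1 : Z₀ ≠ 1) :
    IsZMonoprime ↥(C.bsFld.carrier (op W)) ∨ IsQMonoprime ↥(C.bsFld.carrier (op W)) := by
  rcases C.isMonoprime_bsFld (op W) with hZ | hQ' | hR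
  · exact Or.inl hZ
  · exact Or.inr hQ'
  · exact absurd hR (not_isRMonoprime_bsFld_weak hQ hZ₀b hZ₀1)

/-- **Part (d) of row C38-L05 at the WEAK tree vocabulary, WITHOUT `hSup` and without `hΛ`.**
[cite: MochizukiEtTh2009, Cor 3.8 p.81] -/
theorem isBaseFieldTheoreticDiv_iff_isLUB_divOPf_coordWeak
    {T' : RealifiedDivisorMonoids (D₀ := D₀) treeMonoidVocabWeak.{w}} {C : TemperedFrobenioid T' D VD}
    (hP34Λ : ∀ (Y : D₀ᵒᵖ) (b : T'.BΛ.obj Y) (r : T'.ΦR.obj Y),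
      T'.divΛ Y b = Algebra.GrothendieckGroup.of r → b ∈ T'.FΛ Y)
    (hNZ : ∀ A : Dᵒᵖ, ∃ u : (T'.BΛ.obj (C.baseOp A) : Type w) × Algebra.GrothendieckGroup (C.Φ.carrier A),
      u ∈ C.cnstFn A ∧ ∃ Z : C.Φ.carrier A, Z ≠ 1 ∧ u.2 = Algebra.GrothendieckGroup.of Z)
    {W : D} (hQ : ∀ 𝔮 : Primes (Perfection (C.divisorMonoid.obj (op W))),
      IsQMonoprime (PfAt (C.divisorMonoid.obj (op W)) 𝔮))
    (x : C.divisorMonoid.obj (op W)) :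
    C.IsBaseFieldTheoreticDiv x ↔
      ∃ S : Set (Perfection (C.divisorMonoid.obj (op W))), S ⊆ C.divOPf W ∧ S.Nonempty ∧
        DirectedOn (fun a b => a ∣ b) S ∧ (∀ s ∈ S, s ∣ Perfection.of _ x) ∧
        ∀ z, (∀ s ∈ S, s ∣ z) → Perfection.of _ x ∣ z := by
  obtain ⟨Z₀, hZ₀, hZ₀b, hZ₀1⟩ := exists_divO_ne_one hNZ W
  have hΛ := isZQMonoprime_bsFld_weak hQ hZ₀b hZ₀1
  constructor
  · intro hx
    refine ⟨{Perfection.of _ x}, ?_, Set.singleton_nonempty _, ?_, ?_, ?_⟩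
    · rintro _ rfl
      exact of_mem_divOPf_of_isBaseFieldTheoreticDiv hΛ hZ₀ hZ₀b hZ₀1 hx
    · rintro _ rfl _ rfl
      exact ⟨_, rfl, dvd_rfl, dvd_rfl⟩
    · rintro _ rfl
      exact dvd_rfl
    · intro z hz
      exact hz _ rfl
  · rintro ⟨S, hS, hne, -, hbd, hlub⟩
    have hM := isPerfFactorialWeak_divisorMonoid (C := C) W
    obtain ⟨κ, hinj, hord, hrat⟩ := Cor38Coord.exists_pfCoord_weak hM
    exact isBaseFieldTheoreticDiv_of_isLUB_bsFldPf_of_pfCoord hΛ hM.isDivisorial.isSharp κ hinj hord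
      (fun 𝔮 => hrat 𝔮 (hQ 𝔮)) hZ₀b hZ₀1 x (hS.trans (divOPf_subset_bsFldPf hP34Λ W)) hne hbd hlub

/-- **Row C38-L05 of the [EtTh] Cor. 3.8 sub-DAG at the WEAK tree vocabulary, WITHOUT `hSup` (and without `hΛ`)**:
for THE perfection of the Frobenioid of a tempered Frobenioid over Def. 3.6 (i) data read with `treeMonoidVocabWeak`
(tempered coverings with infinitely many special-fibre components), a pre-step is base-field-theoretic iff its image
in `C^pf` is a cofiltered limit in `(C^pf)^coa-pre_B` of pre-steps abstractly equivalent to an element of some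
`O^▷(−)` — GIVEN `hF`, `hP34Λ` (typed field of the Def. 3.3 data), `hNZ` (Def. 3.6 (ii)(b)) and `hQ` only.
[cite: MochizukiEtTh2009, Cor 3.8 p.81] -/
theorem bsFldPreStepLimitCriterion_of_coordWeak
    {T' : RealifiedDivisorMonoids (D₀ := D₀) treeMonoidVocabWeak.{w}} (C : TemperedFrobenioid T' D VD) (hF : PreFrobenioid.IsFrobenioid C.toElem)
    (hP34Λ : ∀ (Y : D₀ᵒᵖ) (b : T'.BΛ.obj Y) (r : T'.ΦR.obj Y),
      T'.divΛ Y b = Algebra.GrothendieckGroup.of r → b ∈ T'.FΛ Y)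
    (hNZ : ∀ A : Dᵒᵖ, ∃ u : (T'.BΛ.obj (C.baseOp A) : Type w) × Algebra.GrothendieckGroup (C.Φ.carrier A),
      u ∈ C.cnstFn A ∧ ∃ Z : C.Φ.carrier A, Z ≠ 1 ∧ u.2 = Algebra.GrothendieckGroup.of Z)
    (hQ : ∀ (W : D) (𝔮 : Primes (Perfection (C.divisorMonoid.obj (op W)))),
      IsQMonoprime (PfAt (C.divisorMonoid.obj (op W)) 𝔮)) :
    C.BsFldPreStepLimitCriterion (PreFrobenioidData.perfection hF) := by
  intro A B φ hφ
  have hψ : (PreFrobenioidData.perfection hF).ops.IsCoAngularPreStep ((PreFrobenioidData.perfection hF).toPf.map φ) :=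
    Cor38Criterion.isCoAngularPreStep_of_isPreStep (PreFrobenioid.Perfection.preservesMor_isPreStep hF φ hφ)
  rw [Cor38Criterion.isLimitOfOTriLike_iff_isLUB_divOPf _ hψ, sliceDiv_toPf hF φ hφ.2 hψ,
    isBaseFieldTheoretic_iff_invDiv φ hφ.2]
  exact isBaseFieldTheoreticDiv_iff_isLUB_divOPf_coordWeak hP34Λ hNZ (hQ _) _

end Weak

end TemperedFrobenioid

end Literature.AnabelianGeometry.EtaleTheta
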